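import Literature.NumberTheory.Automorphic.Liu2021.Def411WeilCarriersDoublingUnique
import Literature.NumberTheory.Weil1964.AdelicMetaplecticTwistCharacter
import HarnessLib

/-!
# Rigidity of the `χ`-normalised doubled Weil representation: no character twists trivial on the Siegel parabolic

For the doubled unitary group `H(𝔸) = U(𝕍 ⊕ −𝕍)(𝔸_{L⁺})` of [GelbartRogawski1991, §3.1 Prop. 3.1.1] / [Kudla1994, §2]
(`DoubledUnitaryGlobalSplittingData`) and a `χ`-normalised doubled Weil representation `sD` (`IsDoubledWeilRep χ sD`):
**`IsDoubledWeilRep.monoidHom_eq_one_of_forall_isSiegelDelta`** — if `η : H(𝔸) →* ℂˣ` is continuous and `η p = 1` for every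
Siegel `p` (`IsSiegelDelta p`, unit `det_Δ p`), then `η = 1`.  PROOF: the twist `sD ⊗ η` (`adelicMpCont.twist`) is again continuous,
lies over `ι^𝔻` (`proj_twist`) and satisfies the SAME parabolic clause (`twist_eq_of_eq_one` where `η = 1`), i.e.
`IsDoubledWeilRep χ (sD ⊗ η)`; by UNIQUENESS `doubledWeilRep_eq_of_isDoubledWeilRep` ([GelbartRogawski1991] Prop. 3.1.1, Remark
p. 457; [Kudla1994] Thm. 3.1) `sD ⊗ η = sD = sD ⊗ 1`, and `twist_right_injective` gives `η = 1`.

This is the `hrigid` input of `Weil1964/AdelicMetaplecticSeesawRigid` for the see-saw of the doubled groups along the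
block-diagonal embedding `H(V₁) × H(V₂) ↪ H(V₁ ⊕ V₂)` (`DoubledSeesawParabolic`).

References: [GelbartRogawski1991] S. Gelbart, J. Rogawski, Invent. Math. 105 (1991) §3.1 Prop. 3.1.1 p. 455, Remark p. 457;
[Kudla1994] S. Kudla, Israel J. Math. 87 (1994) Thm. 3.1; [Kudla1984] S. Kudla, Progr. Math. 46 (1984) §1.
-/

set_option autoImplicit false

noncomputable section

open scoped Matrix
open NumberField IsDedekindDomain
open Literature.NumberTheory.Weil1964 Literature.NumberTheory.Automorphic
open Literature.RepresentationTheory.HarrisKudlaSweet1996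
open Literature.NumberTheory.GaloisRepresentations

namespace Literature.NumberTheory.GelbartRogawski1991.GRConstruction

open Literature.NumberTheory.Automorphic.Liu2021.Def411WeilCarriersDoubling

variable (L : Type) [Field L] [NumberField L] [IsCMField L]
  {N M n : ℕ} (e : Fin N × Fin M ≃ Fin n)
  (dV : Fin N → L) (hdV : ∀ i, IsCMField.complexConj L (dV i) = dV i) (hdV0 : ∀ i, dV i ≠ 0)
  (dW : Fin M → L) (hdW : ∀ i, IsCMField.complexConj L (dW i) = dW i) (hdW0 : ∀ i, dW i ≠ 0)

/-- twisting by the trivial character changes nothing. [folklore] -/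
private theorem twist_one' {F : Type} [Field F] [NumberField F] {ι : Type} [Fintype ι] [DecidableEq ι]
    {T : Matrix ι ι (AdeleRing (𝓞 F) F)} {H : Type*} [Group H] (s : H →* adelicMpCont F ι T) :
    adelicMpCont.twist F ι T s 1 = s :=
  MonoidHom.ext fun h => adelicMpCont.twist_eq_of_eq_one s 1 (MonoidHom.one_apply h)

/-- **A `χ`-normalised doubled Weil representation admits no non-trivial continuous character twist trivial on the Siegel
parabolic.**  If `sD` is the doubled Weil representation of `H(𝔸) = U(𝕍 ⊕ −𝕍)(𝔸)` with character `χ` (★ `IsDoubledWeilRep`) and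
`η : H(𝔸) →* ℂˣ` is continuous with `η p = 1` for every Siegel `p` (`IsSiegelDelta p`, unit `det_Δ p`), then `η = 1` — the twist
`sD ⊗ η` is again `χ`-normalised, hence equals `sD` by uniqueness. [cite: GelbartRogawski1991, §3.1 Prop. 3.1.1 p. 455, Remark p. 457]
[cite: Kudla1994, Thm. 3.1] -/
theorem IsDoubledWeilRep.monoidHom_eq_one_of_forall_isSiegelDelta (χ : HeckeCharacter L) (hχu : χ.IsUnitary)
    (hχs : IsSplittingChar L 1 χ) {sD : HA L e dV hdV dW hdW →* MpD L e dV hdV dW hdW}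
    (hD : IsDoubledWeilRep L e dV hdV hdV0 dW hdW hdW0 χ sD)
    (η : HA L e dV hdV dW hdW →* ℂˣ) (hηc : Continuous fun p => ((η p : ℂˣ) : ℂ))
    (hη : ∀ p : HA L e dV hdV dW hdW, IsSiegelDelta L e dV hdV dW hdW p → IsUnit (detDelta L e dV hdV dW hdW p) → η p = 1) :
    η = 1 := by
  -- the twist is again a `χ`-normalised doubled Weil representation
  have hD' : IsDoubledWeilRep L e dV hdV hdV0 dW hdW hdW0 χ
      (adelicMpCont.twist (Fp L) (Fin (n + n)) (gramDA L e dV hdV dW hdW) sD η) :=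
    { continuous := adelicMpCont.continuous_twist sD η hD.continuous hηc
      proj_eq := fun h => (adelicMpCont.proj_twist sD η h).trans (hD.proj_eq h)
      parabolic := fun p hp hu Φ =>
        (congrArg (fun x : MpD L e dV hdV dW hdW =>
            opD L e dV hdV dW hdW (rDelta L e dV hdV hdV0 dW hdW hdW0 * x * (rDelta L e dV hdV hdV0 dW hdW hdW0)⁻¹) Φ 0)
          (adelicMpCont.twist_eq_of_eq_one sD η (hη p hp hu))).trans (hD.parabolic p hp hu Φ) }
  -- uniqueness: both equal `doubledWeilRep χ`
  have h1 := doubledWeilRep_eq_of_isDoubledWeilRep L e dV hdV hdV0 dW hdW hdW0 χ hχu hχs hD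
  have h2 := doubledWeilRep_eq_of_isDoubledWeilRep L e dV hdV hdV0 dW hdW hdW0 χ hχu hχs hD'
  have h3 : adelicMpCont.twist (Fp L) (Fin (n + n)) (gramDA L e dV hdV dW hdW) sD η =
      adelicMpCont.twist (Fp L) (Fin (n + n)) (gramDA L e dV hdV dW hdW) sD 1 :=
    h2.symm.trans (h1.trans (twist_one' sD).symm)
  exact adelicMpCont.twist_right_injective sD h3

end Literature.NumberTheory.GelbartRogawski1991.GRConstruction

end
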